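import Mathlib
import Summits.Ventures.PercRepro2.TypedSpineSt
import Summits.Ventures.PercRepro2.StarPattern
import Summits.Ventures.PercRepro2.TypedHatConn

/-!
# The hat rule: an unmarked vertex of typed degree 3 on the root pair (blind cell PercRepro2,
p2 g0, 2026-08-25; sub-claim S1; the lead's ruling 04:33:25Z (1) «p2 takes (A): the TypedStar
rule», mine-1's MINE1-J1.md §23.9 / §23.11)

A **hat** is an unmarked vertex `u` whose typed edges are exactly `e_v = u–v`, `e₁ = u–a₁`,
`e₂ = u–a₂` (`v ≠ a₁, a₂`), every other edge at `u` pinned closed (`TypedHatConn.lean`). Grouping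
the placements of the three edges by what the copies see gives the kernel-agnostic identity
(mine-1 §23.9, the four star identities with the hyperedge terms vanishing): for types
`(τ e_v, τ e₁, τ e₂) ∈ {1, 2}³`,

  `N_τ = Σ_{t₁, t₂} hatCoef (τ e_v) (τ e₁) (τ e₂) t₁ t₂ · N'(va₁ ↦ t₁, va₂ ↦ t₂)`

where `N'` is the typed count of the graph with `u` removed, `e_v` re-mapped to `v–a₁`, `e₁` to
`v–a₂`, `e₂` dropped (`hatEnds`), and the table is: (1,1,1) ↦ 2·va₁(1) + 2·va₂(1) + 6·∅;
(1,1,2) ↦ va₁(1) + 2·va₂(1); (1,2,1) ↦ 2·va₁(1) + va₂(1); (2,1,1) ↦ 2·va₁(1) + 2·va₂(1) +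
va₁(1)va₂(1); (2,1,2) ↦ va₂(2) + va₁(1)va₂(1); (2,2,1) ↦ va₁(2) + va₁(1)va₂(1); (1,2,2), (2,2,2) ↦ 0
(every coefficient a nonnegative integer: no comparison, no hyperedge).

* `stKer_hat` — the state kernel of the three copies through the hat;
* `hat_sum` — the placement identity (a finite identity, `Σ_{a+b+c = k}` expanded);
* `typedCount_split2` / `typedCount_split3` — two / three typed edges split off, nested;
* **`typedCount_hat_st`** — the hat rule for every state kernel with the root-pair property;
* **`typedCount_hat`** — the hat rule for `K₃`.

Own code; standard axioms.
-/

namespace Summit.Ventures.PercRepro2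

open UnionCluster

namespace CovForm

namespace TypedRed

open OneTyped

/-! ## The kernel through a hat -/

section Kernel

variable {V : Type*} {E : Type*} [DecidableEq V] [Fintype E] [DecidableEq E] {R : Type*} [Field R]
variable (ends : E → Sym2 V) (o a₁ a₂ a₃ b : V) (KK : St → St → St → R)

omit [DecidableEq V] [Fintype E] in
/-- **The state kernel through a hat**: on configurations closed on the hat's edges and elsewhere
at `u`, the kernel of the three copies with the hat's edges opened as `(a, a', a'')`, … is the
kernel of the re-mapped copies opening `v–a₁` iff `seenA`, `v–a₂` iff `seenB`. -/
theorem stKer_hat (hq : ∀ x y w : St, x.q' = true ∨ y.q' = true ∨ w.q' = true → KK x y w = 0)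
    {u v : V} {e_v e₁ e₂ : E} (hv : ends e_v = s(u, v)) (h1 : ends e₁ = s(u, a₁))
    (h2 : ends e₂ = s(u, a₂)) (hv1 : e_v ≠ e₁) (hv2 : e_v ≠ e₂) (h12 : e₁ ≠ e₂)
    (huo : u ≠ o) (hu1 : u ≠ a₁) (hu2 : u ≠ a₂) (hu3 : u ≠ a₃) (hub : u ≠ b)
    {x y w : Config E} (hx2 : x e₂ = false) (hy2 : y e₂ = false) (hw2 : w e₂ = false)
    (hxcl : ∀ e, u ∈ ends e → e ≠ e_v → e ≠ e₁ → e ≠ e₂ → x e = false)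
    (hycl : ∀ e, u ∈ ends e → e ≠ e_v → e ≠ e₁ → e ≠ e₂ → y e = false)
    (hwcl : ∀ e, u ∈ ends e → e ≠ e_v → e ≠ e₁ → e ≠ e₂ → w e = false)
    (a a' a'' d d' d'' c c' c'' : Bool) :
    stKer ends o a₁ a₂ a₃ b KK
        (Function.update (Function.update (Function.update x e₂ a'') e₁ a') e_v a)
        (Function.update (Function.update (Function.update y e₂ d'') e₁ d') e_v d)
        (Function.update (Function.update (Function.update w e₂ c'') e₁ c') e_v c) =
      stKer (hatEnds ends e_v e₁ v a₁ a₂) o a₁ a₂ a₃ b KK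
        (Function.update (Function.update x e₁ (seenB a a' a'')) e_v (seenA a a' a''))
        (Function.update (Function.update y e₁ (seenB d d' d'')) e_v (seenA d d' d''))
        (Function.update (Function.update w e₁ (seenB c c' c'')) e_v (seenA c c' c'')) := by
  -- the values of the updated copies
  have hat_v : ∀ (x : Config E) (p q r : Bool),
      Function.update (Function.update (Function.update x e₂ r) e₁ q) e_v p e_v = p :=
    fun x p q r => Function.update_self _ _ _
  have hat_1 : ∀ (x : Config E) (p q r : Bool),
      Function.update (Function.update (Function.update x e₂ r) e₁ q) e_v p e₁ = q := by
    intro x p q r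
    rw [Function.update_of_ne hv1.symm, Function.update_self]
  have hat_2 : ∀ (x : Config E) (p q r : Bool),
      Function.update (Function.update (Function.update x e₂ r) e₁ q) e_v p e₂ = r := by
    intro x p q r
    rw [Function.update_of_ne hv2.symm, Function.update_of_ne h12.symm, Function.update_self]
  have re_v : ∀ (x : Config E) (p q : Bool), Function.update (Function.update x e₁ q) e_v p e_v = p :=
    fun x p q => Function.update_self _ _ _
  have re_1 : ∀ (x : Config E) (p q : Bool), Function.update (Function.update x e₁ q) e_v p e₁ = q := by
    intro x p q
    rw [Function.update_of_ne hv1.symm, Function.update_self]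
  have re_2 : ∀ (x : Config E) (p q : Bool), Function.update (Function.update x e₁ q) e_v p e₂ = x e₂ := by
    intro x p q
    rw [Function.update_of_ne hv2.symm, Function.update_of_ne h12.symm]
  have agree : ∀ (x : Config E) (p q r p' q' : Bool) (e : E), e ≠ e_v → e ≠ e₁ → e ≠ e₂ →
      Function.update (Function.update x e₁ q') e_v p' e =
        Function.update (Function.update (Function.update x e₂ r) e₁ q) e_v p e := by
    intro x p q r p' q' e h₁ h₂ h₃
    simp only [Function.update_of_ne h₁, Function.update_of_ne h₂, Function.update_of_ne h₃]
  have closed : ∀ (x : Config E), (∀ e, u ∈ ends e → e ≠ e_v → e ≠ e₁ → e ≠ e₂ → x e = false) →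
      ∀ (p q r : Bool) (e : E), u ∈ ends e → e ≠ e_v → e ≠ e₁ → e ≠ e₂ →
      Function.update (Function.update (Function.update x e₂ r) e₁ q) e_v p e = false := by
    intro x hx p q r e hue h₁ h₂ h₃
    simp only [Function.update_of_ne h₁, Function.update_of_ne h₂, Function.update_of_ne h₃]
    exact hx e hue h₁ h₂ h₃
  -- a killed copy kills both sides
  by_cases kx : a' = true ∧ a'' = true
  · unfold stKer
    rw [hq _ _ _ (Or.inl (st_q'_of_hat_both ends o a₁ a₂ a₃ b h1 h2 ((hat_1 x a a' a'').trans kx.1)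
        ((hat_2 x a a' a'').trans kx.2))),
      hq _ _ _ (Or.inl (st_q'_of_hatEnds_both ends o a₁ a₂ a₃ b hv1
        ((re_v x _ _).trans (seenA_of_both kx)) ((re_1 x _ _).trans (seenB_of_both kx))))]
  by_cases ky : d' = true ∧ d'' = true
  · unfold stKer
    rw [hq _ _ _ (Or.inr (Or.inl (st_q'_of_hat_both ends o a₁ a₂ a₃ b h1 h2
        ((hat_1 y d d' d'').trans ky.1) ((hat_2 y d d' d'').trans ky.2)))),
      hq _ _ _ (Or.inr (Or.inl (st_q'_of_hatEnds_both ends o a₁ a₂ a₃ b hv1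
        ((re_v y _ _).trans (seenA_of_both ky)) ((re_1 y _ _).trans (seenB_of_both ky)))))]
  by_cases kw : c' = true ∧ c'' = true
  · unfold stKer
    rw [hq _ _ _ (Or.inr (Or.inr (st_q'_of_hat_both ends o a₁ a₂ a₃ b h1 h2
        ((hat_1 w c c' c'').trans kw.1) ((hat_2 w c c' c'').trans kw.2)))),
      hq _ _ _ (Or.inr (Or.inr (st_q'_of_hatEnds_both ends o a₁ a₂ a₃ b hv1
        ((re_v w _ _).trans (seenA_of_both kw)) ((re_1 w _ _).trans (seenB_of_both kw)))))]
  -- no copy killed: the states agree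
  unfold stKer
  rw [st_hat ends o a₁ a₂ a₃ b hv h1 h2 hv1 hv2 h12 huo hu1 hu2 hu3 hub _ _ (hat_v x a a' a'')
      (hat_1 x a a' a'') (hat_2 x a a' a'') ((re_v x _ _).trans (seenA_of_not_both kx))
      ((re_1 x _ _).trans (seenB_of_not_both kx)) ((re_2 x _ _).trans hx2)
      (agree x a a' a'' _ _) (closed x hxcl a a' a'') kx,
    st_hat ends o a₁ a₂ a₃ b hv h1 h2 hv1 hv2 h12 huo hu1 hu2 hu3 hub _ _ (hat_v y d d' d'')
      (hat_1 y d d' d'') (hat_2 y d d' d'') ((re_v y _ _).trans (seenA_of_not_both ky))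
      ((re_1 y _ _).trans (seenB_of_not_both ky)) ((re_2 y _ _).trans hy2)
      (agree y d d' d'' _ _) (closed y hycl d d' d'') ky,
    st_hat ends o a₁ a₂ a₃ b hv h1 h2 hv1 hv2 h12 huo hu1 hu2 hu3 hub _ _ (hat_v w c c' c'')
      (hat_1 w c c' c'') (hat_2 w c c' c'') ((re_v w _ _).trans (seenA_of_not_both kw))
      ((re_1 w _ _).trans (seenB_of_not_both kw)) ((re_2 w _ _).trans hw2)
      (agree w c c' c'' _ _) (closed w hwcl c c' c'') kw]

end Kernel

/-! ## The placement identity -/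

section Sums

variable {R : Type*} [CommRing R]

/-- `Σ_{a+b+c = 0} h a b c = h false false false`. -/
lemma sum_bool3_zero (h : Bool → Bool → Bool → R) :
    (∑ a : Bool, ∑ b : Bool, ∑ c : Bool, if a.toNat + b.toNat + c.toNat = 0 then h a b c else 0) =
      h false false false := by
  simp only [Fintype.sum_bool, Bool.toNat_true, Bool.toNat_false]
  norm_num

/-- **The placement identity behind the hat rule**: summing a function of what the copies see over
the placements of the hat's three edges (types `tv, t1, t2 ∈ {1, 2}`) is the `hatCoef`-weighted
sum over the placements of the two re-mapped edges, for any `g` vanishing on a killed copy. -/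
lemma hat_sum {tv t1 t2 : ℕ} (htv : tv = 1 ∨ tv = 2) (ht1 : t1 = 1 ∨ t1 = 2) (ht2 : t2 = 1 ∨ t2 = 2)
    (T : Bool → Bool → Bool → Bool → Bool → Bool → Bool → Bool → Bool → R)
    (g : Bool → Bool → Bool → Bool → Bool → Bool → R)
    (hT : ∀ a b c a' b' c' a'' b'' c'', T a b c a' b' c' a'' b'' c'' =
      g (seenA a a' a'') (seenB a a' a'') (seenA b b' b'') (seenB b b' b'') (seenA c c' c'')
        (seenB c c' c''))
    (hk1 : ∀ b b' c c', g true true b b' c c' = 0) (hk2 : ∀ a a' c c', g a a' true true c c' = 0)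
    (hk3 : ∀ a a' b b', g a a' b b' true true = 0) :
    (∑ a : Bool, ∑ b : Bool, ∑ c : Bool, if a.toNat + b.toNat + c.toNat = tv then
      (∑ a' : Bool, ∑ b' : Bool, ∑ c' : Bool, if a'.toNat + b'.toNat + c'.toNat = t1 then
        (∑ a'' : Bool, ∑ b'' : Bool, ∑ c'' : Bool, if a''.toNat + b''.toNat + c''.toNat = t2 then
          T a b c a' b' c' a'' b'' c'' else 0) else 0) else 0) =
    ∑ t₁ ∈ Finset.range 3, ∑ t₂ ∈ Finset.range 3, (hatCoef tv t1 t2 t₁ t₂ : R) *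
      ∑ a : Bool, ∑ b : Bool, ∑ c : Bool, if a.toNat + b.toNat + c.toNat = t₁ then
        (∑ a' : Bool, ∑ b' : Bool, ∑ c' : Bool, if a'.toNat + b'.toNat + c'.toNat = t₂ then
          g a a' b b' c c' else 0) else 0 := by
  simp only [hT]
  rcases htv with rfl | rfl <;> rcases ht1 with rfl | rfl <;> rcases ht2 with rfl | rfl <;>
  · simp only [Finset.sum_range_succ, Finset.sum_range_zero, sum_bool3_zero,
      StarPattern.sum_bool3_one, StarPattern.sum_bool3_two, seenA, seenB, Bool.and_true,
      Bool.and_false, Bool.or_true, Bool.or_false, Bool.or_self, hk1, hk2, hk3, hatCoef]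
    norm_num <;> ring

end Sums

/-! ## Splitting two and three typed edges off -/

section Split

variable {E : Type*} [Fintype E] [DecidableEq E] {R : Type*} [CommRing R]

/-- Two typed edges split off, nested. -/
lemma typedCount_split2 (F : Finset E) {e₁ e₂ : E} (h1 : e₁ ∈ F) (h2 : e₂ ∈ F) (h12 : e₁ ≠ e₂)
    (z : Config E) (τ : E → ℕ) (K : Config E → Config E → Config E → R) :
    typedCount F z τ K =
      ∑ a : Bool, ∑ b : Bool, ∑ c : Bool, if a.toNat + b.toNat + c.toNat = τ e₁ then
        (∑ a' : Bool, ∑ b' : Bool, ∑ c' : Bool, if a'.toNat + b'.toNat + c'.toNat = τ e₂ then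
          typedCount ((F.erase e₁).erase e₂) (Function.update (Function.update z e₁ false) e₂ false)
            τ (fun x y w => K (Function.update (Function.update x e₂ a') e₁ a)
              (Function.update (Function.update y e₂ b') e₁ b)
              (Function.update (Function.update w e₂ c') e₁ c))
        else 0) else 0 := by
  rw [typedCount_split F e₁ h1]
  refine Finset.sum_congr rfl fun a _ => Finset.sum_congr rfl fun b _ =>
    Finset.sum_congr rfl fun c _ => ?_
  by_cases hA : a.toNat + b.toNat + c.toNat = τ e₁
  · rw [if_pos hA, if_pos hA, typedCount_split (F.erase e₁) e₂ (Finset.mem_erase.2 ⟨h12.symm, h2⟩)]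
  · rw [if_neg hA, if_neg hA]

/-- Three typed edges split off, nested. -/
lemma typedCount_split3 (F : Finset E) {e₁ e₂ e₃ : E} (h1 : e₁ ∈ F) (h2 : e₂ ∈ F) (h3 : e₃ ∈ F)
    (h12 : e₁ ≠ e₂) (h13 : e₁ ≠ e₃) (h23 : e₂ ≠ e₃) (z : Config E) (τ : E → ℕ)
    (K : Config E → Config E → Config E → R) :
    typedCount F z τ K =
      ∑ a : Bool, ∑ b : Bool, ∑ c : Bool, if a.toNat + b.toNat + c.toNat = τ e₁ then
        (∑ a' : Bool, ∑ b' : Bool, ∑ c' : Bool, if a'.toNat + b'.toNat + c'.toNat = τ e₂ then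
          (∑ a'' : Bool, ∑ b'' : Bool, ∑ c'' : Bool, if a''.toNat + b''.toNat + c''.toNat = τ e₃ then
            typedCount (((F.erase e₁).erase e₂).erase e₃)
              (Function.update (Function.update (Function.update z e₁ false) e₂ false) e₃ false) τ
              (fun x y w =>
                K (Function.update (Function.update (Function.update x e₃ a'') e₂ a') e₁ a)
                  (Function.update (Function.update (Function.update y e₃ b'') e₂ b') e₁ b)
                  (Function.update (Function.update (Function.update w e₃ c'') e₂ c') e₁ c))
          else 0) else 0) else 0 := by
  rw [typedCount_split2 F h1 h2 h12]
  refine Finset.sum_congr rfl fun a _ => Finset.sum_congr rfl fun b _ =>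
    Finset.sum_congr rfl fun c _ => ?_
  by_cases hA : a.toNat + b.toNat + c.toNat = τ e₁
  · rw [if_pos hA, if_pos hA]
    refine Finset.sum_congr rfl fun a' _ => Finset.sum_congr rfl fun b' _ =>
      Finset.sum_congr rfl fun c' _ => ?_
    by_cases hB : a'.toNat + b'.toNat + c'.toNat = τ e₂
    · rw [if_pos hB, if_pos hB, typedCount_split ((F.erase e₁).erase e₂) e₃
        (Finset.mem_erase.2 ⟨h23.symm, Finset.mem_erase.2 ⟨h13.symm, h3⟩⟩)]
    · rw [if_neg hB, if_neg hB]
  · rw [if_neg hA, if_neg hA]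

end Split

/-! ## The hat rule -/

section HatRule

variable {V : Type*} {E : Type*} [DecidableEq V] [Fintype E] [DecidableEq E] {R : Type*} [Field R]
variable (ends : E → Sym2 V) (o a₁ a₂ a₃ b : V) (KK : St → St → St → R)

omit [DecidableEq V] in
/-- **THE HAT RULE for state kernels with the root-pair property.** `u` is unmarked with typed edges
exactly `e_v = u–v`, `e₁ = u–a₁`, `e₂ = u–a₂` (types in `{1, 2}`), every other edge at `u` pinned
closed and untyped. Then the typed count is the `hatCoef`-combination of the typed counts of the
graph with `u` removed, `e_v` re-mapped to `v–a₁` (type `t₁`), `e₁` to `v–a₂` (type `t₂`), `e₂`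
dropped. -/
theorem typedCount_hat_st (hq : ∀ x y w : St, x.q' = true ∨ y.q' = true ∨ w.q' = true → KK x y w = 0)
    {u v : V} {e_v e₁ e₂ : E} (hv : ends e_v = s(u, v)) (h1 : ends e₁ = s(u, a₁))
    (h2 : ends e₂ = s(u, a₂)) (hv1 : e_v ≠ e₁) (hv2 : e_v ≠ e₂) (h12 : e₁ ≠ e₂)
    (huo : u ≠ o) (hu1 : u ≠ a₁) (hu2 : u ≠ a₂) (hu3 : u ≠ a₃) (hub : u ≠ b)
    (F : Finset E) (hvF : e_v ∈ F) (h1F : e₁ ∈ F) (h2F : e₂ ∈ F) (z : Config E)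
    (hcl : ∀ e, u ∈ ends e → e ≠ e_v → e ≠ e₁ → e ≠ e₂ → e ∉ F ∧ z e = false)
    (τ : E → ℕ) (hτv : τ e_v = 1 ∨ τ e_v = 2) (hτ1 : τ e₁ = 1 ∨ τ e₁ = 2)
    (hτ2 : τ e₂ = 1 ∨ τ e₂ = 2) :
    typedCount F z τ (stKer ends o a₁ a₂ a₃ b KK) =
      ∑ t₁ ∈ Finset.range 3, ∑ t₂ ∈ Finset.range 3, (hatCoef (τ e_v) (τ e₁) (τ e₂) t₁ t₂ : R) *
        typedCount (F.erase e₂) (Function.update z e₂ false)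
          (Function.update (Function.update τ e_v t₁) e₁ t₂)
          (stKer (hatEnds ends e_v e₁ v a₁ a₂) o a₁ a₂ a₃ b KK) := by
  set ends' := hatEnds ends e_v e₁ v a₁ a₂ with hends'
  set F₀ := ((F.erase e_v).erase e₁).erase e₂ with hF₀
  set z₀ := Function.update (Function.update (Function.update z e_v false) e₁ false) e₂ false
    with hz₀
  -- the base quantity: the re-mapped count at a placement of the two new edges
  set g : Bool → Bool → Bool → Bool → Bool → Bool → R := fun a a' d d' c c' =>
    typedCount F₀ z₀ τ (fun x y w => stKer ends' o a₁ a₂ a₃ b KK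
      (Function.update (Function.update x e₁ a') e_v a)
      (Function.update (Function.update y e₁ d') e_v d)
      (Function.update (Function.update w e₁ c') e_v c)) with hg
  -- the pinned values of `z₀` at the hat
  have hz₀v : z₀ e_v = false := by
    rw [hz₀, Function.update_of_ne hv2, Function.update_of_ne hv1, Function.update_self]
  have hz₀1 : z₀ e₁ = false := by
    rw [hz₀, Function.update_of_ne h12, Function.update_self]
  have hz₀2 : z₀ e₂ = false := by
    rw [hz₀, Function.update_self]
  have hz₀o : ∀ e, e ≠ e_v → e ≠ e₁ → e ≠ e₂ → z₀ e = z e := by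
    intro e h₁ h₂ h₃
    rw [hz₀, Function.update_of_ne h₃, Function.update_of_ne h₂, Function.update_of_ne h₁]
  have hF₀v : e_v ∉ F₀ := fun h =>
    (Finset.mem_erase.1 (Finset.mem_erase.1 (Finset.mem_erase.1 h).2).2).1 rfl
  have hF₀1 : e₁ ∉ F₀ := fun h => (Finset.mem_erase.1 (Finset.mem_erase.1 h).2).1 rfl
  have hF₀2 : e₂ ∉ F₀ := fun h => (Finset.mem_erase.1 h).1 rfl
  -- a configuration agreeing with `z₀` off `F₀` is closed on the hat's edges and elsewhere at `u`
  have hclosed : ∀ x : Config E, (∀ e, e ∉ F₀ → x e = z₀ e) →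
      x e₂ = false ∧ ∀ e, u ∈ ends e → e ≠ e_v → e ≠ e₁ → e ≠ e₂ → x e = false := by
    intro x hx
    refine ⟨(hx e₂ hF₀2).trans hz₀2, fun e hue h₁ h₂ h₃ => ?_⟩
    have heF : e ∉ F₀ := fun h =>
      (hcl e hue h₁ h₂ h₃).1 (Finset.mem_of_mem_erase (Finset.mem_of_mem_erase
        (Finset.mem_of_mem_erase h)))
    rw [hx e heF, hz₀o e h₁ h₂ h₃]
    exact (hcl e hue h₁ h₂ h₃).2
  -- the left side: every placement term is `g` of what the copies see
  have hT : ∀ a d c a' d' c' a'' d'' c'' : Bool,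
      typedCount F₀ z₀ τ (fun x y w => stKer ends o a₁ a₂ a₃ b KK
        (Function.update (Function.update (Function.update x e₂ a'') e₁ a') e_v a)
        (Function.update (Function.update (Function.update y e₂ d'') e₁ d') e_v d)
        (Function.update (Function.update (Function.update w e₂ c'') e₁ c') e_v c)) =
      g (seenA a a' a'') (seenB a a' a'') (seenA d d' d'') (seenB d d' d'') (seenA c c' c'')
        (seenB c c' c'') := by
    intro a d c a' d' c' a'' d'' c''
    refine typedCount_congr_K_on _ _ _ fun x y w hxyw _ => ?_
    obtain ⟨hx2, hxcl⟩ := hclosed x fun e he => (hxyw e he).1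
    obtain ⟨hy2, hycl⟩ := hclosed y fun e he => (hxyw e he).2.1
    obtain ⟨hw2, hwcl⟩ := hclosed w fun e he => (hxyw e he).2.2
    exact stKer_hat ends o a₁ a₂ a₃ b KK hq hv h1 h2 hv1 hv2 h12 huo hu1 hu2 hu3 hub hx2 hy2 hw2
      hxcl hycl hwcl a a' a'' d d' d'' c c' c''
  -- `g` vanishes on a killed copy
  have hzero : ∀ K : Config E → Config E → Config E → R, (∀ x y w, K x y w = 0) →
      typedCount F₀ z₀ τ K = 0 := by
    intro K hK
    unfold typedCount
    simp only [hK, ite_self, Finset.sum_const_zero]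
  have hk1 : ∀ d d' c c', g true true d d' c c' = 0 := by
    intro d d' c c'
    refine hzero _ fun x y w => ?_
    show KK _ _ _ = 0
    exact hq _ _ _ (Or.inl (st_q'_of_hatEnds_both ends o a₁ a₂ a₃ b hv1
      (Function.update_self _ _ _) (by rw [Function.update_of_ne hv1.symm, Function.update_self])))
  have hk2 : ∀ a a' c c', g a a' true true c c' = 0 := by
    intro a a' c c'
    refine hzero _ fun x y w => ?_
    show KK _ _ _ = 0
    exact hq _ _ _ (Or.inr (Or.inl (st_q'_of_hatEnds_both ends o a₁ a₂ a₃ b hv1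
      (Function.update_self _ _ _) (by rw [Function.update_of_ne hv1.symm, Function.update_self]))))
  have hk3 : ∀ a a' d d', g a a' d d' true true = 0 := by
    intro a a' d d'
    refine hzero _ fun x y w => ?_
    show KK _ _ _ = 0
    exact hq _ _ _ (Or.inr (Or.inr (st_q'_of_hatEnds_both ends o a₁ a₂ a₃ b hv1
      (Function.update_self _ _ _) (by rw [Function.update_of_ne hv1.symm, Function.update_self]))))
  -- the right side: each re-mapped count is the placement sum of `g`
  have hR : ∀ t₁ t₂ : ℕ,
      typedCount (F.erase e₂) (Function.update z e₂ false)
        (Function.update (Function.update τ e_v t₁) e₁ t₂) (stKer ends' o a₁ a₂ a₃ b KK) =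
      ∑ a : Bool, ∑ d : Bool, ∑ c : Bool, if a.toNat + d.toNat + c.toNat = t₁ then
        (∑ a' : Bool, ∑ d' : Bool, ∑ c' : Bool, if a'.toNat + d'.toNat + c'.toNat = t₂ then
          g a a' d d' c c' else 0) else 0 := by
    intro t₁ t₂
    have hvF' : e_v ∈ F.erase e₂ := Finset.mem_erase.2 ⟨hv2, hvF⟩
    have h1F' : e₁ ∈ F.erase e₂ := Finset.mem_erase.2 ⟨h12, h1F⟩
    rw [typedCount_split2 (F.erase e₂) hvF' h1F' hv1]
    have hτv' : Function.update (Function.update τ e_v t₁) e₁ t₂ e_v = t₁ := by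
      rw [Function.update_of_ne hv1, Function.update_self]
    have hτ1' : Function.update (Function.update τ e_v t₁) e₁ t₂ e₁ = t₂ := Function.update_self _ _ _
    have hFF : ((F.erase e₂).erase e_v).erase e₁ = F₀ := by
      rw [hF₀]
      ext e
      simp only [Finset.mem_erase]
      tauto
    have hzz : Function.update (Function.update (Function.update z e₂ false) e_v false) e₁ false =
        z₀ := by
      funext e
      rw [hz₀]
      simp only [Function.update_apply]
      split_ifs <;> rfl
    rw [hτv', hτ1', hFF, hzz]
    refine Finset.sum_congr rfl fun a _ => Finset.sum_congr rfl fun d _ =>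
      Finset.sum_congr rfl fun c _ => ?_
    refine if_congr Iff.rfl ?_ rfl
    refine Finset.sum_congr rfl fun a' _ => Finset.sum_congr rfl fun d' _ =>
      Finset.sum_congr rfl fun c' _ => ?_
    refine if_congr Iff.rfl ?_ rfl
    exact typedCount_congr_τ F₀ z₀ (fun e he => by
      rw [Function.update_of_ne (fun h : e = e₁ => hF₀1 (h ▸ he)),
        Function.update_of_ne (fun h : e = e_v => hF₀v (h ▸ he))]) _
  -- assemble
  rw [typedCount_split3 F hvF h1F h2F hv1 hv2 h12]
  rw [hat_sum hτv hτ1 hτ2 _ g hT hk1 hk2 hk3]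
  exact Finset.sum_congr rfl fun t₁ _ => Finset.sum_congr rfl fun t₂ _ => by rw [hR t₁ t₂]

omit [DecidableEq V] in
/-- **THE HAT RULE for `K₃`.** -/
theorem typedCount_hat {u v : V} {e_v e₁ e₂ : E} (hv : ends e_v = s(u, v)) (h1 : ends e₁ = s(u, a₁))
    (h2 : ends e₂ = s(u, a₂)) (hv1 : e_v ≠ e₁) (hv2 : e_v ≠ e₂) (h12 : e₁ ≠ e₂)
    (huo : u ≠ o) (hu1 : u ≠ a₁) (hu2 : u ≠ a₂) (hu3 : u ≠ a₃) (hub : u ≠ b)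
    (F : Finset E) (hvF : e_v ∈ F) (h1F : e₁ ∈ F) (h2F : e₂ ∈ F) (z : Config E)
    (hcl : ∀ e, u ∈ ends e → e ≠ e_v → e ≠ e₁ → e ≠ e₂ → e ∉ F ∧ z e = false)
    (τ : E → ℕ) (hτv : τ e_v = 1 ∨ τ e_v = 2) (hτ1 : τ e₁ = 1 ∨ τ e₁ = 2)
    (hτ2 : τ e₂ = 1 ∨ τ e₂ = 2) :
    typedCount F z τ (K3 ends o a₁ a₂ a₃ b : Config E → Config E → Config E → R) =
      ∑ t₁ ∈ Finset.range 3, ∑ t₂ ∈ Finset.range 3, (hatCoef (τ e_v) (τ e₁) (τ e₂) t₁ t₂ : R) *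
        typedCount (F.erase e₂) (Function.update z e₂ false)
          (Function.update (Function.update τ e_v t₁) e₁ t₂)
          (K3 (hatEnds ends e_v e₁ v a₁ a₂) o a₁ a₂ a₃ b) := by
  simp only [K3_eq_stKer]
  exact typedCount_hat_st ends o a₁ a₂ a₃ b _ (ruleKernel_KB (R := R)).root_pair hv h1 h2 hv1 hv2 h12
    huo hu1 hu2 hu3 hub F hvF h1F h2F z hcl τ hτv hτ1 hτ2

end HatRule

end TypedRed

end CovForm

end Summit.Ventures.PercRepro2
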